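import Mathlib
import HarnessLib
import Literature.Computability.AlgebraicComplexity.PatternExpressions
import Literature.Combinatorics.SimpleGraph.TreeDecomposition

/-!
# Route MonotoneRestoration, crux `MonotoneRestorationQP` (stmt-15886), line `linear-width` —
# caterpillar patterns: homomorphism polynomials of stars and double stars, and their treewidth

Helper file (`--supports stmt-ValiantsHypothesis-15886`), def-free.  The combinatorial half of the
certified saturation remark for the registered stub `stub_degreeLifting` of
`Cruxes/MonotoneRestorationQP/Lines/linear_width.lean` (the algebraic half is
`Theorems/…LinearWidthMomentAlignment.lean`): the CATERPILLAR MOMENTS of a point `M ∈ ℂ^{n×n}` are values of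
homomorphism polynomials (tree `homPoly`) of patterns of treewidth `≤ 2` — so they are available under
the hypothesis `HomIndist n k M M'` of the line as soon as `k ≥ 3`.

* `eval_homPoly` — `hom_{F,n}(M) = Σ_{h, h'} Π_{(a,b) ∈ E} M_{h a, h' b}`;
* `eval_homPoly_rowStar` / `eval_homPoly_colStar` — the star `K_{1,m}` centred at a row (column) vertex
  evaluates to the power sum `Σ_u r_u^m` (`Σ_v c_v^m`) of the row (column) sums;
* `eval_homPoly_doubleStar` — the double star (spine edge `u — v`, `m` column leaves at `u`, `m'` row
  leaves at `v`) evaluates to the mixed moment `Σ_{u,v} r_u^m · M_uv · c_v^{m'}`;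
* `treewidth_patternGraph_le_two_of_spine` — a bipartite pattern all of whose edges touch a fixed row
  vertex or a fixed column vertex (stars, double stars) has a path decomposition with bags of size `≤ 3`,
  hence treewidth `≤ 2` (the true value `1` is not needed), stated for the pattern graph
  `SimpleGraph.fromRel (fun u v => ∃ p ∈ E, u = inl p.1 ∧ v = inr p.2)` of the line, verbatim.
-/

-- `Summit.ValiantsHypothesis.ValiantsHypothesis.…` is the tree's mandated namespace (Sub = Summit).
set_option linter.dupNamespace false

noncomputable section

namespace Summit.ValiantsHypothesis.ValiantsHypothesis.Theorems

namespace CaterpillarHom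

open Literature.Computability.AlgebraicComplexity MvPolynomial

/-! ### Evaluating homomorphism polynomials -/

/-- **Evaluation of a homomorphism polynomial**: `hom_{F,n}(M) = Σ_{h : A → [n], h' : B → [n]}
Π_{(a,b) ∈ E} M_{h a, h' b}`. [cite: DwivediPagoSeppelt2026, eq. (1)] -/
theorem eval_homPoly {A B : Type} [Fintype A] [DecidableEq A] [Fintype B] [DecidableEq B]
    (E : Multiset (A × B)) (n : ℕ) (M : Fin n × Fin n → ℂ) :
    eval M (homPoly E n ℂ) =
      ∑ h : (A → Fin n) × (B → Fin n), (E.map fun e => M (h.1 e.1, h.2 e.2)).prod := by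
  unfold homPoly
  rw [map_sum]
  refine Finset.sum_congr rfl fun h _ => ?_
  rw [map_multiset_prod, Multiset.map_map]
  simp

/-- **The row star** `K_{1,m}` (one row vertex joined to `m` column vertices) evaluates to the `m`-th
power sum of the ROW sums. [folklore] -/
theorem eval_homPoly_rowStar (m n : ℕ) (M : Fin n × Fin n → ℂ) :
    eval M (homPoly (((Finset.univ : Finset (Fin m)).val.map fun j => ((0 : Fin 1), j))) n ℂ) =
      ∑ u, (∑ j, M (u, j)) ^ m := by
  rw [eval_homPoly, Fintype.sum_prod_type]
  have key : ∀ (h1 : Fin 1 → Fin n) (h2 : Fin m → Fin n),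
      ((((Finset.univ : Finset (Fin m)).val.map fun j => ((0 : Fin 1), j))).map
        fun e => M (h1 e.1, h2 e.2)).prod = ∏ j, M (h1 0, h2 j) := by
    intro h1 h2
    rw [Multiset.map_map]
    rfl
  simp_rw [key]
  calc ∑ h1 : Fin 1 → Fin n, ∑ h2 : Fin m → Fin n, ∏ j, M (h1 0, h2 j)
      = ∑ h1 : Fin 1 → Fin n, (∑ j, M (h1 0, j)) ^ m :=
        Finset.sum_congr rfl fun h1 _ => (Fintype.sum_pow (fun j => M (h1 0, j)) m).symm
    _ = ∑ u, (∑ j, M (u, j)) ^ m :=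
        Fintype.sum_equiv (Equiv.funUnique (Fin 1) (Fin n)) _ _ fun h1 => rfl

/-- **The column star** (one column vertex joined to `m` row vertices) evaluates to the `m`-th power sum
of the COLUMN sums. [folklore] -/
theorem eval_homPoly_colStar (m n : ℕ) (M : Fin n × Fin n → ℂ) :
    eval M (homPoly (((Finset.univ : Finset (Fin m)).val.map fun i => (i, (0 : Fin 1)))) n ℂ) =
      ∑ v, (∑ i, M (i, v)) ^ m := by
  rw [eval_homPoly, Fintype.sum_prod_type, Finset.sum_comm]
  have key : ∀ (h1 : Fin m → Fin n) (h2 : Fin 1 → Fin n),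
      ((((Finset.univ : Finset (Fin m)).val.map fun i => (i, (0 : Fin 1)))).map
        fun e => M (h1 e.1, h2 e.2)).prod = ∏ i, M (h1 i, h2 0) := by
    intro h1 h2
    rw [Multiset.map_map]
    rfl
  simp_rw [key]
  calc ∑ h2 : Fin 1 → Fin n, ∑ h1 : Fin m → Fin n, ∏ i, M (h1 i, h2 0)
      = ∑ h2 : Fin 1 → Fin n, (∑ i, M (i, h2 0)) ^ m :=
        Finset.sum_congr rfl fun h2 _ => (Fintype.sum_pow (fun i => M (i, h2 0)) m).symm
    _ = ∑ v, (∑ i, M (i, v)) ^ m :=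
        Fintype.sum_equiv (Equiv.funUnique (Fin 1) (Fin n)) _ _ fun h2 => rfl

/-- **The double star** — spine edge between row vertex `0` and column vertex `0`, `m` column leaves
`1, …, m` at the row vertex, `m'` row leaves `1, …, m'` at the column vertex — evaluates to the mixed
caterpillar moment `Σ_{u,v} r_u^m · M_uv · c_v^{m'}`. [folklore] -/
theorem eval_homPoly_doubleStar (m m' n : ℕ) (M : Fin n × Fin n → ℂ) :
    eval M (homPoly ((((0 : Fin (m' + 1)), (0 : Fin (m + 1))) ::ₘ
        (((Finset.univ : Finset (Fin m)).val.map fun j => ((0 : Fin (m' + 1)), j.succ)) +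
          ((Finset.univ : Finset (Fin m')).val.map fun i => (i.succ, (0 : Fin (m + 1))))))) n ℂ) =
      ∑ u, ∑ v, (∑ j, M (u, j)) ^ m * M (u, v) * (∑ i, M (i, v)) ^ m' := by
  rw [eval_homPoly]
  have key : ∀ (h : (Fin (m' + 1) → Fin n) × (Fin (m + 1) → Fin n)),
      ((((0 : Fin (m' + 1)), (0 : Fin (m + 1))) ::ₘ
        (((Finset.univ : Finset (Fin m)).val.map fun j => ((0 : Fin (m' + 1)), j.succ)) +
          ((Finset.univ : Finset (Fin m')).val.map fun i => (i.succ, (0 : Fin (m + 1)))))).map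
        fun e => M (h.1 e.1, h.2 e.2)).prod =
      M (h.1 0, h.2 0) * ((∏ j : Fin m, M (h.1 0, h.2 j.succ)) * ∏ i : Fin m', M (h.1 i.succ, h.2 0)) := by
    intro h
    rw [Multiset.map_cons, Multiset.prod_cons, Multiset.map_add, Multiset.prod_add,
      Multiset.map_map, Multiset.map_map]
    rfl
  simp_rw [key]
  -- split both label assignments into (spine value, leaf values)
  have split : ∑ h : (Fin (m' + 1) → Fin n) × (Fin (m + 1) → Fin n),
      M (h.1 0, h.2 0) * ((∏ j : Fin m, M (h.1 0, h.2 j.succ)) * ∏ i : Fin m', M (h.1 i.succ, h.2 0)) =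
      ∑ q : (Fin n × (Fin m' → Fin n)) × (Fin n × (Fin m → Fin n)),
        M (q.1.1, q.2.1) * ((∏ j : Fin m, M (q.1.1, q.2.2 j)) * ∏ i : Fin m', M (q.1.2 i, q.2.1)) := by
    rw [← ((Fin.consEquiv fun _ : Fin (m' + 1) => Fin n).prodCongr
      (Fin.consEquiv fun _ : Fin (m + 1) => Fin n)).sum_comp]
    refine Finset.sum_congr rfl fun q _ => ?_
    simp only [Equiv.prodCongr_apply, Prod.map, Fin.consEquiv_apply, Fin.cons_zero, Fin.cons_succ]
  rw [split, Fintype.sum_prod_type]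
  simp only [Fintype.sum_prod_type]
  -- now `∑ u, ∑ g, ∑ v, ∑ g', M (u,v) * ((∏ j, M (u, g' j)) * ∏ i, M (g i, v))`
  refine Finset.sum_congr rfl fun u _ => ?_
  rw [Finset.sum_comm]
  refine Finset.sum_congr rfl fun v _ => ?_
  rw [Fintype.sum_pow, Fintype.sum_pow]
  simp only [Finset.mul_sum, Finset.sum_mul]
  exact Finset.sum_congr rfl fun g _ => Finset.sum_congr rfl fun g' _ => by ring

/-! ### Treewidth of stars and double stars -/

/-- **Patterns with a spine have treewidth `≤ 2`.**  If every edge of the bipartite pattern `E` has its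
row end at a fixed vertex `x` or its column end at a fixed vertex `y`, then the pattern graph (on
`Fin a ⊕ Fin b`, the `patternGraph` of line `linear-width`) has the path decomposition with bags
`{x, y, z}`, `z` running over all vertices; every bag has `≤ 3` elements, so the treewidth is `≤ 2`.
(Stars and double stars are trees, treewidth `1`; the weaker bound is all the line needs.) [folklore] -/
theorem treewidth_patternGraph_le_two_of_spine {a b : ℕ} (E : Multiset (Fin a × Fin b))
    (x y : Fin a ⊕ Fin b) (hE : ∀ p ∈ E, Sum.inl p.1 = x ∨ Sum.inr p.2 = y) :
    Literature.Combinatorics.SimpleGraph.treewidth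
      (SimpleGraph.fromRel fun u v : Fin a ⊕ Fin b => ∃ p ∈ E, u = Sum.inl p.1 ∧ v = Sum.inr p.2) ≤ 2 := by
  classical
  set G : SimpleGraph (Fin a ⊕ Fin b) :=
    SimpleGraph.fromRel fun u v : Fin a ⊕ Fin b => ∃ p ∈ E, u = Sum.inl p.1 ∧ v = Sum.inr p.2 with hG
  -- the vertex type is nonempty, so its cardinality `a + b` is a successor
  obtain ⟨k, hk⟩ : ∃ k, a + b = k + 1 :=
    Nat.exists_eq_add_one_of_ne_zero (by
      have : 0 < Fintype.card (Fin a ⊕ Fin b) := Fintype.card_pos_iff.2 ⟨x⟩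
      simp only [Fintype.card_sum, Fintype.card_fin] at this
      omega)
  let e : (Fin a ⊕ Fin b) ≃ Fin (k + 1) := finSumFinEquiv.trans (finCongr hk)
  let B : Fin (k + 1) → Finset (Fin a ⊕ Fin b) := fun t => {x, y, e.symm t}
  have hx : ∀ t, x ∈ B t := fun t => by simp [B]
  have hy : ∀ t, y ∈ B t := fun t => by simp [B]
  have hz : ∀ z, z ∈ B (e z) := fun z => by simp [B]
  refine Literature.Combinatorics.SimpleGraph.treewidth_le_of_intervals G B ?_ (fun z => ⟨e z, hz z⟩) ?_
    (w := 2) ?_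
  · -- (T2) every edge has a spine end, which lies in every bag
    intro u v huv
    rw [hG, SimpleGraph.fromRel_adj] at huv
    obtain ⟨-, h | h⟩ := huv
    · obtain ⟨p, hp, rfl, rfl⟩ := h
      rcases hE p hp with h1 | h2
      · exact ⟨e (Sum.inr p.2), h1 ▸ hx _, hz _⟩
      · exact ⟨e (Sum.inl p.1), hz _, h2 ▸ hy _⟩
    · obtain ⟨p, hp, rfl, rfl⟩ := h
      rcases hE p hp with h1 | h2
      · exact ⟨e (Sum.inr p.2), hz _, h1 ▸ hx _⟩
      · exact ⟨e (Sum.inl p.1), h2 ▸ hy _, hz _⟩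
  · -- the bags containing a vertex form an interval: all of them, or exactly one
    intro z
    refine Set.ordConnected_iff.2 fun s hs t ht _ i hi => ?_
    simp only [Set.mem_setOf_eq, B, Finset.mem_insert, Finset.mem_singleton] at hs ht ⊢
    rcases hs with rfl | rfl | hs
    · exact Or.inl rfl
    · exact Or.inr (Or.inl rfl)
    · rcases ht with rfl | rfl | ht
      · exact Or.inl rfl
      · exact Or.inr (Or.inl rfl)
      · have hst : s = t := e.symm.injective (hs.symm.trans ht)
        subst hst
        have : i = s := le_antisymm (by simpa using hi.2) hi.1
        exact Or.inr (Or.inr (this ▸ hs))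
  · intro t
    simp only [B]
    exact (Finset.card_insert_le _ _).trans (by
      have := Finset.card_insert_le y ({e.symm t} : Finset (Fin a ⊕ Fin b))
      simp only [Finset.card_singleton] at this
      omega)

/-- The row star has treewidth `≤ 2`. [folklore] -/
theorem treewidth_rowStar_le (m : ℕ) :
    Literature.Combinatorics.SimpleGraph.treewidth
      (SimpleGraph.fromRel fun u v : Fin 1 ⊕ Fin m =>
        ∃ p ∈ (((Finset.univ : Finset (Fin m)).val.map fun j => ((0 : Fin 1), j))),
          u = Sum.inl p.1 ∧ v = Sum.inr p.2) ≤ 2 := by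
  refine treewidth_patternGraph_le_two_of_spine _ (Sum.inl 0) (Sum.inl 0) fun p hp => Or.inl ?_
  obtain ⟨j, -, rfl⟩ := Multiset.mem_map.1 hp
  rfl

/-- The column star has treewidth `≤ 2`. [folklore] -/
theorem treewidth_colStar_le (m : ℕ) :
    Literature.Combinatorics.SimpleGraph.treewidth
      (SimpleGraph.fromRel fun u v : Fin m ⊕ Fin 1 =>
        ∃ p ∈ (((Finset.univ : Finset (Fin m)).val.map fun i => (i, (0 : Fin 1)))),
          u = Sum.inl p.1 ∧ v = Sum.inr p.2) ≤ 2 := by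
  refine treewidth_patternGraph_le_two_of_spine _ (Sum.inr 0) (Sum.inr 0) fun p hp => Or.inr ?_
  obtain ⟨i, -, rfl⟩ := Multiset.mem_map.1 hp
  rfl

/-- The double star has treewidth `≤ 2`. [folklore] -/
theorem treewidth_doubleStar_le (m m' : ℕ) :
    Literature.Combinatorics.SimpleGraph.treewidth
      (SimpleGraph.fromRel fun u v : Fin (m' + 1) ⊕ Fin (m + 1) =>
        ∃ p ∈ (((0 : Fin (m' + 1)), (0 : Fin (m + 1))) ::ₘ
          (((Finset.univ : Finset (Fin m)).val.map fun j => ((0 : Fin (m' + 1)), j.succ)) +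
            ((Finset.univ : Finset (Fin m')).val.map fun i => (i.succ, (0 : Fin (m + 1)))))),
          u = Sum.inl p.1 ∧ v = Sum.inr p.2) ≤ 2 := by
  refine treewidth_patternGraph_le_two_of_spine _ (Sum.inl 0) (Sum.inr 0) fun p hp => ?_
  rw [Multiset.mem_cons, Multiset.mem_add, Multiset.mem_map, Multiset.mem_map] at hp
  rcases hp with rfl | ⟨j, -, rfl⟩ | ⟨i, -, rfl⟩
  · exact Or.inl rfl
  · exact Or.inl rfl
  · exact Or.inr rfl

end CaterpillarHom

end Summit.ValiantsHypothesis.ValiantsHypothesis.Theorems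

end
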